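import Summits.Schanuel.Schanuel.Theorems.ZilberEacRealSplitLevel
import Summits.Schanuel.Schanuel.Theorems.ZilberEacRealParamCore
import Summits.Schanuel.Schanuel.Theorems.ZilberEacRealSplitDensity
import HarnessLib

/-!
# Totally real hyperplane × PARAMETRISED space curve: exponential points and their density in `ℂ³ × ℂ³`

Zilber's Exponential-Algebraic Closedness, case ladder (host summit Schanuel, cell `pub-schanuel`,
seat 2, gen 7).  The parametrised versions of `ZilberEacRealSplit` / `ZilberEacRealSplitDensity`:
the fibre curve is an arbitrary POLYNOMIALLY PARAMETRISED curve `t ↦ (q₁(t), …, q_s(t), p₀(t))`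
(graph curves: `p₀ = t`).

* `exists_expPoint_realSplitParam` (all `s`): `r ∈ ℝˢ` with some `r_{j₀} ∉ ℚ`, `c ∈ ℂ`, `qⱼ, p₀ ≠ 0`,
  `deg p₀ ≠ Σ rⱼ deg qⱼ` ⟹ `∃ x t, e^{xⱼ} = qⱼ(t) (∀ j) ∧ e^{Σ rⱼ xⱼ + c} = p₀(t)`: the `(s+1)`-fold
  `W = {(x, Σ rⱼxⱼ + c ; q(t), p₀(t))}` (totally real hyperplane × parametrised curve) meets `Γ_exp`.
* `unprojectedDense_realSplitParam_two` (`s = 2`): for `r₁ ∉ ℚ` the exponential points of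
  `W = {(x₀, x₁, r₀x₀ + r₁x₁ + c ; q₀(t), q₁(t), p₀(t))} ⊆ ℂ³ × ℂ³` are ZARISKI DENSE in `W` — members
  of `EC(3,2)` with NON-GRAPH fibre curves, e.g. the plane `x₂ = √2 x₀ + √3 x₁` times the space curve
  `t ↦ (t² + 1, t³ + 1, t² - t)` (`unprojectedDense_sqrt_two_sqrt_three_spaceCurve`).

**HONEST FRAMING.** Existence ⊂ Gallinaro 2023 Thm 8.8 (`L × W`) in print; the elementary method and
the density statements are new.  Explicit families, not the cell; nothing here bears on Schanuel's
conjecture; `ECCell 3 2` OPEN.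
-/

noncomputable section

open MvPolynomial Filter Topology Complex Metric
open Literature.NumberTheory.Transcendental Literature.ModelTheory.Zilber
  Literature.ModelTheory.ExponentialFields

set_option linter.dupNamespace false

namespace Summit.Schanuel.Schanuel.Theorems

section SplitParam

variable {s : ℕ}

/-- Level point, parametrised: `log |p₀(t)| = Σⱼ rⱼ log |qⱼ(t)| + Re c` with all values nonzero,
provided `deg p₀ ≠ Σ rⱼ deg qⱼ` (`exists_zero_weightedLogNorm` for `(p₀, q)`, weights `(1, -r)`). -/
theorem exists_splitParamLevelPoint (r : Fin s → ℝ) (c : ℂ) {q : Fin s → Polynomial ℂ}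
    (hq : ∀ j, q j ≠ 0) {p₀ : Polynomial ℂ} (hp₀ : p₀ ≠ 0)
    (hdeg : (p₀.natDegree : ℝ) ≠ ∑ j, r j * ((q j).natDegree : ℝ)) :
    ∃ t : ℂ, p₀.eval t ≠ 0 ∧ (∀ j, (q j).eval t ≠ 0) ∧
      Real.log ‖p₀.eval t‖ = ∑ j, r j * Real.log ‖(q j).eval t‖ + c.re := by
  set p : Fin (s + 1) → Polynomial ℂ := Fin.cons p₀ q with hp
  set w : Fin (s + 1) → ℝ := Fin.cons 1 (fun j => -r j) with hw
  have hp0 : ∀ i, p i ≠ 0 := by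
    refine Fin.cases ?_ (fun j => ?_)
    · simpa [hp] using hp₀
    · simpa [hp] using hq j
  have hdeg' : ∑ i, w i * (p i).natDegree ≠ 0 := by
    rw [Fin.sum_univ_succ]
    simp only [hw, hp, Fin.cons_zero, Fin.cons_succ, one_mul, neg_mul, Finset.sum_neg_distrib]
    intro h
    apply hdeg
    linarith
  obtain ⟨t, ht, hφ⟩ := exists_zero_weightedLogNorm w (-c.re) hp0 hdeg'
  refine ⟨t, ?_, fun j => ?_, ?_⟩
  · have := ht 0
    simpa [hp] using this
  · have := ht j.succ
    simpa [hp] using this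
  · rw [Fin.sum_univ_succ] at hφ
    simp only [hw, hp, Fin.cons_zero, Fin.cons_succ, one_mul, neg_mul,
      Finset.sum_neg_distrib] at hφ
    linarith

/-- **THEOREM (totally real hyperplane × parametrised curve, all `s`).** -/
theorem exists_expPoint_realSplitParam (r : Fin s → ℝ) {j₀ : Fin s} (hj₀ : Irrational (r j₀))
    (c : ℂ) {q : Fin s → Polynomial ℂ} (hq : ∀ j, q j ≠ 0) {p₀ : Polynomial ℂ} (hp₀ : p₀ ≠ 0)
    (hdeg : (p₀.natDegree : ℝ) ≠ ∑ j, r j * ((q j).natDegree : ℝ)) :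
    ∃ (x : Fin s → ℂ) (t : ℂ), (∀ j, exp (x j) = (q j).eval t) ∧
      exp (∑ i, (r i : ℂ) * x i + c) = p₀.eval t := by
  obtain ⟨t₀, ht₀, hqt₀, hlev⟩ := exists_splitParamLevelPoint r c hq hp₀ hdeg
  obtain ⟨A, Λ, hA, hcore⟩ := realParam_core r hj₀ c hdeg ht₀ hqt₀ hlev
  obtain ⟨α, hα⟩ := hA.nonempty
  obtain ⟨x, w, -, -, -, hxw⟩ := hcore α hα 0
  exact ⟨x 0, w 0, (hxw 0).1, (hxw 0).2⟩

/-- **THEOREM (Zariski density, plane × parametrised space curve in `ℂ³ × ℂ³`).**  `r₁` irrational,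
`q₀, q₁, p₀ ≠ 0`, `deg p₀ ≠ r₀ deg q₀ + r₁ deg q₁` ⟹ the exponential points of
`W = {(x₀, x₁, r₀ x₀ + r₁ x₁ + c ; q₀(t), q₁(t), p₀(t))}` are Zariski dense in `W`. -/
theorem unprojectedDense_realSplitParam_two (r : Fin 2 → ℝ) (hr : Irrational (r 1)) (c : ℂ)
    {q : Fin 2 → Polynomial ℂ} (hq : ∀ j, q j ≠ 0) {p₀ : Polynomial ℂ} (hp₀ : p₀ ≠ 0)
    (hdeg : (p₀.natDegree : ℝ) ≠ ∑ j, r j * ((q j).natDegree : ℝ)) :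
    UnprojectedDense {z : Fin 3 ⊕ Fin 3 → ℂ | ∃ a b t : ℂ,
      z = Sum.elim ![a, b, (r 0 : ℂ) * a + (r 1 : ℂ) * b + c]
        ![(q 0).eval t, (q 1).eval t, p₀.eval t]} := by
  classical
  set W := {z : Fin 3 ⊕ Fin 3 → ℂ | ∃ a b t : ℂ,
      z = Sum.elim ![a, b, (r 0 : ℂ) * a + (r 1 : ℂ) * b + c]
        ![(q 0).eval t, (q 1).eval t, p₀.eval t]} with hW
  -- the parametrisation
  set pt : ℂ → ℂ → ℂ → Fin 3 ⊕ Fin 3 → ℂ := fun u a z =>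
    Sum.elim ![a, z, (r 0 : ℂ) * a + (r 1 : ℂ) * z + c] ![(q 0).eval u, (q 1).eval u, p₀.eval u]
    with hpt
  have hptW : ∀ u a z, pt u a z ∈ W := fun u a z => ⟨a, z, u, rfl⟩
  have hptΓ : ∀ u a z, exp a = (q 0).eval u → exp z = (q 1).eval u →
      exp ((r 0 : ℂ) * a + (r 1 : ℂ) * z + c) = p₀.eval u → pt u a z ∈ expGraph ℂ 3 := by
    intro u a z h0 h1 h2
    rw [mem_expGraph_iff]
    intro i
    fin_cases i <;> simp [hpt, ExponentialRing.complex_exp_eq, h0, h1, h2]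
  -- the pull-back to `ℂ[t][x₀][x₁]`
  set CCC : ℂ →+* Polynomial (Polynomial (Polynomial ℂ)) :=
    Polynomial.C.comp (Polynomial.C.comp Polynomial.C) with hCCC
  set asym : Polynomial (Polynomial (Polynomial ℂ)) := Polynomial.C Polynomial.X with hasym
  set σ : Fin 3 ⊕ Fin 3 → Polynomial (Polynomial (Polynomial ℂ)) :=
    Sum.elim ![asym, Polynomial.X, CCC (r 0 : ℂ) * asym + CCC (r 1 : ℂ) * Polynomial.X + CCC c]
      ![Polynomial.C (Polynomial.C (q 0)), Polynomial.C (Polynomial.C (q 1)),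
        Polynomial.C (Polynomial.C p₀)] with hσ
  set ev : ℂ → ℂ → ℂ → Polynomial (Polynomial (Polynomial ℂ)) →+* ℂ := fun u a z =>
    Polynomial.eval₂RingHom (mmEval u a) z with hev
  have hevC : ∀ u a z, (ev u a z).comp CCC = RingHom.id ℂ := by
    intro u a z
    ext t
    simp [hev, hCCC, mmEval]
  have hevσ : ∀ u a z, (fun i => ev u a z (σ i)) = pt u a z := by
    intro u a z
    funext i
    rcases i with i | i <;> fin_cases i <;>
      simp [hev, hσ, hpt, hasym, hCCC, mmEval]
  refine le_antisymm ?_ (vanishingIdeal_anti_mono Set.inter_subset_left)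
  intro F hF
  set G : Polynomial (Polynomial (Polynomial ℂ)) := MvPolynomial.eval₂Hom CCC σ F with hG
  have hGeval : ∀ u a z, ev u a z G = MvPolynomial.eval (pt u a z) F := by
    intro u a z
    have h1 := DFunLike.congr_fun (MvPolynomial.comp_eval₂Hom CCC σ (ev u a z)) F
    rw [RingHom.comp_apply, hevC, hevσ] at h1
    rw [hG, h1]
    rfl
  -- a level point and the parametrised core with escaping coordinate `j₀ = 1`
  obtain ⟨t₀, ht₀, hqt₀, hlev⟩ := exists_splitParamLevelPoint r c hq hp₀ hdeg
  obtain ⟨A, Λ, hA, hcore⟩ := realParam_core r (j₀ := 1) hr c hdeg ht₀ hqt₀ hlev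
  have hG0 : G = 0 := by
    by_contra hGne
    have hlc : G.leadingCoeff ≠ 0 := Polynomial.leadingCoeff_ne_zero.2 hGne
    refine hlc (eq_zero_of_forall_mmEval_shift_eq_zero _ hA (Λ 0) fun α hα k => ?_)
    obtain ⟨x, w, hx1, hw, hxlim, hpts⟩ := hcore α hα ![k, 0]
    have hx0 : Tendsto (fun n => x n 0) atTop (𝓝 (Λ 0 α + (k : ℂ) * (2 * Real.pi * I))) := by
      have := hxlim 0 (by decide)
      simpa using this
    refine map_leadingCoeff_eq_zero_of_eval₂_eq_zero G (fun n => mmEval (w n) (x n 0))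
      (mmEval α (Λ 0 α + (k : ℂ) * (2 * Real.pi * I))) (fun P => tendsto_mmEval P hw hx0)
      (fun n => x n 1) hx1 fun n => ?_
    have h2 := hGeval (w n) (x n 0) (x n 1)
    simp only [hev, Polynomial.coe_eval₂RingHom] at h2
    rw [h2]
    refine eval_eq_zero_of_mem_vanishingIdeal hF ⟨hptW _ _ _,
      hptΓ _ _ _ ((hpts n).1 0) ((hpts n).1 1) ?_⟩
    have := (hpts n).2
    simpa [Fin.sum_univ_two] using this
  refine mem_vanishingIdeal_of_eval fun z hz => ?_
  obtain ⟨a, b', t, rfl⟩ := hz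
  have h := hGeval t a b'
  rw [hG0, map_zero] at h
  exact h.symm

/-- **A member of `EC(3,2)` with a NON-GRAPH fibre curve, dense exponential points**: the plane
`x₂ = √2 x₀ + √3 x₁` times the space curve `t ↦ (t² + 1, t³ + 1, t² - t)`; its exponential points —
the solutions of `e^{x₀} = t² + 1`, `e^{x₁} = t³ + 1`, `e^{√2 x₀ + √3 x₁} = t² - t` — are Zariski dense. -/
theorem unprojectedDense_sqrt_two_sqrt_three_spaceCurve :
    UnprojectedDense {z : Fin 3 ⊕ Fin 3 → ℂ | ∃ a b t : ℂ,
      z = Sum.elim ![a, b, ((![Real.sqrt 2, Real.sqrt 3] : Fin 2 → ℝ) 0 : ℂ) * a +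
          ((![Real.sqrt 2, Real.sqrt 3] : Fin 2 → ℝ) 1 : ℂ) * b + 0]
        ![((![Polynomial.X ^ 2 + Polynomial.C 1, Polynomial.X ^ 3 + Polynomial.C 1] :
            Fin 2 → Polynomial ℂ) 0).eval t,
          ((![Polynomial.X ^ 2 + Polynomial.C 1, Polynomial.X ^ 3 + Polynomial.C 1] :
            Fin 2 → Polynomial ℂ) 1).eval t,
          (Polynomial.X ^ 2 - Polynomial.X : Polynomial ℂ).eval t]} := by
  refine unprojectedDense_realSplitParam_two _ (by simpa using Nat.prime_three.irrational_sqrt) 0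
    (fun j => ?_) ?_ ?_
  · fin_cases j
    · intro h
      have := congrArg (Polynomial.eval (0 : ℂ)) h
      norm_num at this
    · intro h
      have := congrArg (Polynomial.eval (0 : ℂ)) h
      norm_num at this
  · intro h
    have := congrArg (Polynomial.eval (2 : ℂ)) h
    norm_num at this
  · have h1 : (Polynomial.X ^ 2 + Polynomial.C (1 : ℂ)).natDegree = 2 :=
      Polynomial.natDegree_X_pow_add_C
    have h2 : (Polynomial.X ^ 3 + Polynomial.C (1 : ℂ)).natDegree = 3 :=
      Polynomial.natDegree_X_pow_add_C
    have h3 : (Polynomial.X ^ 2 - Polynomial.X : Polynomial ℂ).natDegree = 2 := by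
      rw [sub_eq_add_neg, Polynomial.natDegree_add_eq_left_of_natDegree_lt] <;>
        simp [Polynomial.natDegree_neg]
    rw [Fin.sum_univ_two, h3]
    simp only [Matrix.cons_val_zero, Matrix.cons_val_one, h1, h2, Nat.cast_ofNat]
    have h4 : (1 : ℝ) < Real.sqrt 3 := by
      rw [show (1 : ℝ) = Real.sqrt 1 by simp]
      exact Real.sqrt_lt_sqrt (by norm_num) (by norm_num)
    nlinarith [Real.sqrt_nonneg 2]

/-- The space-curve system `e^{x₀} = t² + 1`, `e^{x₁} = t³ + 1`, `e^{√2 x₀ + √3 x₁} = t² - t` is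
solvable. -/
theorem sqrt_two_sqrt_three_spaceCurve_system_solvable :
    ∃ x₀ x₁ t : ℂ, exp x₀ = t ^ 2 + 1 ∧ exp x₁ = t ^ 3 + 1 ∧
      exp ((Real.sqrt 2 : ℂ) * x₀ + (Real.sqrt 3 : ℂ) * x₁) = t ^ 2 - t := by
  have hq : ∀ j : Fin 2, ((![Polynomial.X ^ 2 + Polynomial.C 1, Polynomial.X ^ 3 + Polynomial.C 1] :
      Fin 2 → Polynomial ℂ) j) ≠ 0 := by
    intro j
    fin_cases j
    · intro h
      have := congrArg (Polynomial.eval (0 : ℂ)) h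
      norm_num at this
    · intro h
      have := congrArg (Polynomial.eval (0 : ℂ)) h
      norm_num at this
  have hp : (Polynomial.X ^ 2 - Polynomial.X : Polynomial ℂ) ≠ 0 := by
    intro h
    have := congrArg (Polynomial.eval (2 : ℂ)) h
    norm_num at this
  have hdeg : ((Polynomial.X ^ 2 - Polynomial.X : Polynomial ℂ).natDegree : ℝ) ≠
      ∑ j : Fin 2, (![Real.sqrt 2, Real.sqrt 3] : Fin 2 → ℝ) j *
        ((((![Polynomial.X ^ 2 + Polynomial.C 1, Polynomial.X ^ 3 + Polynomial.C 1] :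
          Fin 2 → Polynomial ℂ) j)).natDegree : ℝ) := by
    have h1 : (Polynomial.X ^ 2 + Polynomial.C (1 : ℂ)).natDegree = 2 :=
      Polynomial.natDegree_X_pow_add_C
    have h2 : (Polynomial.X ^ 3 + Polynomial.C (1 : ℂ)).natDegree = 3 :=
      Polynomial.natDegree_X_pow_add_C
    have h3 : (Polynomial.X ^ 2 - Polynomial.X : Polynomial ℂ).natDegree = 2 := by
      rw [sub_eq_add_neg, Polynomial.natDegree_add_eq_left_of_natDegree_lt] <;>
        simp [Polynomial.natDegree_neg]
    rw [Fin.sum_univ_two, h3]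
    simp only [Matrix.cons_val_zero, Matrix.cons_val_one, h1, h2, Nat.cast_ofNat]
    have h4 : (1 : ℝ) < Real.sqrt 3 := by
      rw [show (1 : ℝ) = Real.sqrt 1 by simp]
      exact Real.sqrt_lt_sqrt (by norm_num) (by norm_num)
    nlinarith [Real.sqrt_nonneg 2]
  obtain ⟨x, t, hx, hp0⟩ := exists_expPoint_realSplitParam ![Real.sqrt 2, Real.sqrt 3] (j₀ := 1)
    (by simpa using Nat.prime_three.irrational_sqrt) 0 hq hp hdeg
  refine ⟨x 0, x 1, t, ?_, ?_, ?_⟩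
  · have := hx 0
    simpa using this
  · have := hx 1
    simpa using this
  · simpa [Fin.sum_univ_two] using hp0

end SplitParam

end Summit.Schanuel.Schanuel.Theorems

end
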